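import Summits.AtomisticToContinuum.HydrodynamicLimit.Theorems.AntiMazurCoboundariesCellForecastPressureDecayEnskogObjects
import Literature.MathematicalPhysics.StatisticalMechanics.HardCoreCanonical
import HarnessLib

/-!
# S2c(C) · tail machinery: the sharp insertion ratio, tree sums with one and two roots, and the
# two-block tree bound (third file of stub `stub_contactStatistics`, crux line `enskog-compensator-martingale`,
# crux `CellForecastPressureDecay`, stmt-AtomisticToContinuum-13915)

Generic convergence ("geometric tail") machinery for the two-marked decorated expansion of the canonical
hard-core gas of independent points (`Literature/MathematicalPhysics/StatisticalMechanics/HardCoreCanonical`,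
`Literature/Probability/LatticeModels/HardCoreUrsell`), uniform in the number of labels `n` once `n p` is small
(`p` = mass of one excluded region):

* § 1 `hcProb_univ_sdiff_mul_pow_le` — **the sharp insertion ratio** `Ξ(univ ∖ B) (1 − n p)^{#B} ≤ Ξ(univ)`
  (iterating `hcProb_insert_ge`), replacing the factor `2^{#B}` of the crude bound by `(1 − n p)^{−#B}`;
* § 2 `lintegral_mul_mul₂_aU_aU_le` — **two marked points in two disjoint blocks** `B ∋ u`, `B' ∋ v` with a
  two-body weight: `∫⁻ φ(x_u) Φ(x_u,x_v) |u_B| |u_{B'}| dℙ ≤ (∫⁻ φ(z) ∫⁻ Φ(z,y) dν(y) dν(z)) t(#B) p^{#B−1} t(#B') p^{#B'−1}`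
  (integrate out `x_u`; given it, the two blocks are independent; tree bound `lintegral_mul_aU_le` twice);
* § 3 tree sums: `∑_{B ∋ i} t(#B) x^{#B−1} = U_x(W ∖ i) ≤ e` (`sum_filter_mem_treeNumber_mul_pow_pred` with
  `treeSum_le_exp_one`) and the **two-root tree sum** `∑_{B ∋ i,j} t(#B) x^{#B−2} ≤ e²` for `2 e x #W ≤ 1`
  (`sum_filter_mem_mem_treeNumber_mul_pow_le`: block decomposition of the tree recursion at `j`);
* § 4 the registered sub-goal `stub_contactStatistics_tail`.

References: E. Pulvirenti, D. Tsagkarogiannis, Comm. Math. Phys. 316 (2012) 289–306, §3–4;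
S. Friedli, Y. Velenik, *Statistical Mechanics of Lattice Systems* (2017), §5.4.
-/

noncomputable section

open MeasureTheory ProbabilityTheory Set Filter Finset
open scoped ENNReal BigOperators
open Literature.Analysis.FluidPDE Literature.MathematicalPhysics.KineticTheory
open Literature.MathematicalPhysics.StatisticalMechanics
open Literature.Probability.LatticeModels (setPartitions mem_setPartitions IsSetPartition treeNumber
  sum_setPartitions_prod_card_mul_treeNumber blockOf)

namespace Summit.AtomisticToContinuum.HydrodynamicLimit.Theorems.EnskogCompensator

section Generic

variable {ι : Type*} [Fintype ι] [DecidableEq ι] {X : Type*} [MeasurableSpace X] {O : X → X → Prop}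
variable (ν : Measure X) [IsProbabilityMeasure ν]

/-! ## § 1 The sharp insertion ratio -/

/-- **Iterated insertion bound, sharp form**: if one ball has mass `≤ p` and `n p ≤ 1` (`n = #ι`), removing
the labels `B` from the hard core costs at most the factor `(1 − n p)^{−#B}`:
`Ξ(univ ∖ B) (1 − n p)^{#B} ≤ Ξ(univ)`. [cite: PulvirentiTsagkarogiannis2012, §3] -/
theorem hcProb_univ_sdiff_mul_pow_le (hO : MeasurableSet {p : X × X | O p.1 p.2})
    (hOs : ∀ a b, O a b → O b a) {p : ℝ} (hp0 : 0 ≤ p) (hp : ∀ z, ν {y | O z y} ≤ ENNReal.ofReal p)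
    (hnp : (Fintype.card ι : ℝ) * p ≤ 1) (B : Finset ι) :
    hcProb O ν ((Finset.univ : Finset ι) \ B) * (1 - Fintype.card ι * p) ^ B.card ≤
      hcProb O ν (Finset.univ : Finset ι) := by
  have hq0 : 0 ≤ 1 - (Fintype.card ι : ℝ) * p := by linarith
  induction B using Finset.induction_on with
  | empty => simp
  | @insert b B hb ih =>
    set W : Finset ι := (Finset.univ : Finset ι) \ insert b B with hW
    have hbW : b ∉ W := by simp [hW]
    have hins : insert b W = (Finset.univ : Finset ι) \ B := by
      ext a
      simp only [hW, Finset.mem_insert, Finset.mem_sdiff, Finset.mem_univ, true_and, not_or]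
      constructor
      · rintro (rfl | ⟨-, haB⟩)
        exacts [hb, haB]
      · intro haB
        by_cases hab : a = b
        exacts [Or.inl hab, Or.inr ⟨hab, haB⟩]
    have hge := hcProb_insert_ge ν hO hOs hp0 hp hbW
    rw [hins] at hge
    have hWn : (W.card : ℝ) ≤ Fintype.card ι := by exact_mod_cast Finset.card_le_univ W
    have hWc : 1 - (Fintype.card ι : ℝ) * p ≤ 1 - W.card * p := by nlinarith
    have h0 : 0 ≤ hcProb O ν W := hcProb_nonneg ν W
    rw [Finset.card_insert_of_notMem hb, pow_succ]
    calc hcProb O ν W * ((1 - Fintype.card ι * p) ^ B.card * (1 - Fintype.card ι * p))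
        = hcProb O ν W * (1 - Fintype.card ι * p) * (1 - Fintype.card ι * p) ^ B.card := by ring
      _ ≤ hcProb O ν W * (1 - W.card * p) * (1 - Fintype.card ι * p) ^ B.card := by
          gcongr
      _ ≤ hcProb O ν ((Finset.univ : Finset ι) \ B) * (1 - Fintype.card ι * p) ^ B.card := by
          gcongr
      _ ≤ hcProb O ν (Finset.univ : Finset ι) := ih

/-! ## § 2 Two marked points in two disjoint blocks -/

/-- **Integrating out the root**: for a measurable weight `w ≥ 0`,
`∫⁻ w(x_u) |u_B(x)| dℙ = ∫⁻ w(y) (∫⁻ |u_B(update x u y)| dℙ(x)) dν(y)`. [folklore] -/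
theorem lintegral_mul_aU_eq_lintegral_update (hO : MeasurableSet {p : X × X | O p.1 p.2}) (B : Finset ι)
    (u : ι) {w : X → ℝ≥0∞} (hw : Measurable w) :
    ∫⁻ x, w (x u) * aU O x B ∂Measure.pi (fun _ : ι => ν) =
      ∫⁻ y, w y * ∫⁻ x, aU O (Function.update x u y) B ∂Measure.pi (fun _ : ι => ν) ∂ν := by
  have hm : Measurable fun x : ι → X => w (x u) * aU O x B :=
    (hw.comp (measurable_pi_apply u)).mul (measurable_aU hO B)
  rw [lintegral_pi_eq_lintegral_update ν u hm]
  simp_rw [Function.update_self]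
  have hsw := lintegral_lintegral_swap (μ := Measure.pi (fun _ : ι => ν)) (ν := ν)
    (f := fun x y => w y * aU O (Function.update x u y) B)
    (((hw.comp measurable_snd)).mul ((measurable_aU hO B).comp measurable_update')).aemeasurable
  rw [hsw]
  refine lintegral_congr fun y => ?_
  have hm2 : Measurable fun x : ι → X => aU O (Function.update x u y) B :=
    (measurable_aU hO B).comp measurable_update_left
  exact lintegral_const_mul _ hm2

/-- **Two marked points in two disjoint blocks.** Let `O` be symmetric and measurable with
`ν{y : O z y} ≤ p` for all `z`, `B ∋ u` and `B' ∋ v` disjoint blocks, `φ ≥ 0` a measurable weight on `X` and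
`Φ ≥ 0` a jointly measurable weight on `X × X`. Then
`∫⁻ φ(x_u) Φ(x_u,x_v) |u_B(x)| |u_{B'}(x)| dℙ ≤ (∫⁻ φ(z) (∫⁻ Φ(z,y) dν(y)) dν(z)) · t(#B) p^{#B−1} · t(#B') p^{#B'−1}`:
integrate out `x_u = z` first; given `z` the factor `Φ(z, x_v) |u_{B'}|` (labels `B'`) and the pinned weight
`|u_B|` (labels `B ∖ u`) are independent; the first is bounded by the tree bound rooted at `v`, and what is
left is the tree bound rooted at `u` with the weight `φ(z) ∫ Φ(z,·) dν`. [cite: PulvirentiTsagkarogiannis2012, §4] -/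
theorem lintegral_mul_mul₂_aU_aU_le (hO : MeasurableSet {p : X × X | O p.1 p.2})
    (hOs : ∀ a b, O a b → O b a) {p : ℝ} (hp0 : 0 ≤ p)
    (hp : ∀ z, ν {y | O z y} ≤ ENNReal.ofReal p) {B B' : Finset ι} {u v : ι} (hu : u ∈ B) (hv : v ∈ B')
    (hBB' : Disjoint B B') {φ : X → ℝ≥0∞} (hφ : Measurable φ) {Φ : X → X → ℝ≥0∞}
    (hΦ : Measurable fun q : X × X => Φ q.1 q.2) :
    ∫⁻ x, φ (x u) * Φ (x u) (x v) * (aU O x B * aU O x B') ∂Measure.pi (fun _ : ι => ν) ≤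
      (∫⁻ z, φ z * ∫⁻ y, Φ z y ∂ν ∂ν) * ENNReal.ofReal (treeNumber B.card * p ^ (B.card - 1)) *
        ENNReal.ofReal (treeNumber B'.card * p ^ (B'.card - 1)) := by
  set P := Measure.pi (fun _ : ι => ν) with hP
  have huv : u ≠ v := fun h => Finset.disjoint_left.1 hBB' hu (h ▸ hv)
  have huB' : u ∉ B' := fun h => Finset.disjoint_left.1 hBB' hu h
  have hφu : Measurable fun x : ι → X => φ (x u) := hφ.comp (measurable_pi_apply u)
  have hΦuv : Measurable fun x : ι → X => Φ (x u) (x v) :=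
    hΦ.comp (f := fun x : ι → X => (x u, x v)) ((measurable_pi_apply u).prodMk (measurable_pi_apply v))
  have hΦy : ∀ y, Measurable (Φ y) := fun y => hΦ.comp (measurable_const.prodMk measurable_id)
  have hM : Measurable fun z => ∫⁻ y, Φ z y ∂ν := hΦ.lintegral_prod_right'
  set K' : ℝ≥0∞ := ENNReal.ofReal (treeNumber B'.card * p ^ (B'.card - 1)) with hK'
  set Bpin : X → ℝ≥0∞ := fun y => ∫⁻ x, aU O (Function.update x u y) B ∂P with hBpin
  -- Step 1: integrate out `x u`
  have hm : Measurable fun x : ι → X => φ (x u) * Φ (x u) (x v) * (aU O x B * aU O x B') :=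
    (hφu.mul hΦuv).mul ((measurable_aU hO B).mul (measurable_aU hO B'))
  rw [lintegral_pi_eq_lintegral_update ν u hm]
  have hupd : ∀ (x : ι → X) (y : X),
      φ (Function.update x u y u) * Φ (Function.update x u y u) (Function.update x u y v) *
          (aU O (Function.update x u y) B * aU O (Function.update x u y) B') =
        φ y * (Φ y (x v) * aU O x B') * aU O (Function.update x u y) B := by
    intro x y
    have hB' : aU O (Function.update x u y) B' = aU O x B' := by
      have h2 : uR O (Function.update x u y) B' = uR O x B' :=
        dependsOn_uR B' fun i hi => Function.update_of_ne
          (show i ≠ u from fun h => huB' (by rw [← h]; exact Finset.mem_coe.1 hi)) _ _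
      simp only [aU, h2]
    rw [Function.update_self, Function.update_of_ne huv.symm, hB']
    ring
  simp_rw [hupd]
  have hsw : ∫⁻ x, ∫⁻ y, φ y * (Φ y (x v) * aU O x B') * aU O (Function.update x u y) B ∂ν ∂P =
      ∫⁻ y, ∫⁻ x, φ y * (Φ y (x v) * aU O x B') * aU O (Function.update x u y) B ∂P ∂ν := by
    refine lintegral_lintegral_swap ((((hφ.comp measurable_snd)).mul ?_).mul
      ((measurable_aU hO B).comp measurable_update')).aemeasurable
    exact (hΦ.comp (f := fun q : (ι → X) × X => (q.2, q.1 v))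
      (measurable_snd.prodMk ((measurable_pi_apply v).comp measurable_fst))).mul
        ((measurable_aU hO B').comp measurable_fst)
  rw [hsw]
  -- Step 2: given `y`, the two blocks are independent
  have hinner : ∀ y, ∫⁻ x, φ y * (Φ y (x v) * aU O x B') * aU O (Function.update x u y) B ∂P ≤
      K' * ((φ y * ∫⁻ b, Φ y b ∂ν) * Bpin y) := by
    intro y
    have hG1m : Measurable fun x : ι → X => Φ y (x v) * aU O x B' :=
      ((hΦy y).comp (measurable_pi_apply v)).mul (measurable_aU hO B')
    have hG2m : Measurable fun x : ι → X => aU O (Function.update x u y) B :=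
      (measurable_aU hO B).comp measurable_update_left
    have hG1d : DependsOn (fun x : ι → X => Φ y (x v) * aU O x B') (B' : Set ι) := by
      intro x x' hxx'
      have h2 : uR O x B' = uR O x' B' := dependsOn_uR B' hxx'
      simp only [aU, h2, hxx' v hv]
    have hG2d : DependsOn (fun x : ι → X => aU O (Function.update x u y) B) (B : Set ι) := by
      intro x x' hxx'
      have h2 : uR O (Function.update x u y) B = uR O (Function.update x' u y) B := by
        refine dependsOn_uR B fun i hi => ?_
        by_cases hiu : i = u
        · subst hiu; simp
        · rw [Function.update_of_ne hiu, Function.update_of_ne hiu, hxx' i hi]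
      simp only [aU, h2]
    have hind := indepFun_of_dependsOn ν hBB'.symm hG1m hG2m hG1d hG2d
    have hfac : ∫⁻ x, (Φ y (x v) * aU O x B') * aU O (Function.update x u y) B ∂P =
        (∫⁻ x, Φ y (x v) * aU O x B' ∂P) * Bpin y :=
      lintegral_mul_eq_lintegral_mul_lintegral_of_indepFun hG1m hG2m hind
    have h1 : ∫⁻ x, Φ y (x v) * aU O x B' ∂P ≤ (∫⁻ b, Φ y b ∂ν) * K' :=
      lintegral_mul_aU_le ν hO hOs hp0 hp B' hv (hΦy y)
    have h3 : ∀ x : ι → X, φ y * (Φ y (x v) * aU O x B') * aU O (Function.update x u y) B =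
        φ y * ((Φ y (x v) * aU O x B') * aU O (Function.update x u y) B) := fun x => by ring
    have hm3 : Measurable fun x : ι → X => (Φ y (x v) * aU O x B') * aU O (Function.update x u y) B :=
      hG1m.mul hG2m
    simp_rw [h3]
    rw [lintegral_const_mul _ hm3, hfac]
    calc φ y * ((∫⁻ x, Φ y (x v) * aU O x B' ∂P) * Bpin y)
        ≤ φ y * (((∫⁻ b, Φ y b ∂ν) * K') * Bpin y) := by gcongr
      _ = K' * ((φ y * ∫⁻ b, Φ y b ∂ν) * Bpin y) := by ring
  -- Step 3: what is left is the tree bound rooted at `u` with the weight `φ · ∫ Φ`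
  calc ∫⁻ y, ∫⁻ x, φ y * (Φ y (x v) * aU O x B') * aU O (Function.update x u y) B ∂P ∂ν
      ≤ ∫⁻ y, K' * ((φ y * ∫⁻ b, Φ y b ∂ν) * Bpin y) ∂ν := lintegral_mono hinner
    _ = K' * ∫⁻ x, (φ (x u) * ∫⁻ b, Φ (x u) b ∂ν) * aU O x B ∂P := by
        have hw : Measurable fun z => φ z * ∫⁻ b, Φ z b ∂ν := hφ.mul hM
        have hBm : Measurable fun y => ∫⁻ x, aU O (Function.update x u y) B ∂P :=
          ((measurable_aU hO B).comp measurable_update').lintegral_prod_left'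
        have hm4 : Measurable fun y => (φ y * ∫⁻ b, Φ y b ∂ν) * Bpin y := hw.mul hBm
        rw [lintegral_const_mul _ hm4, lintegral_mul_aU_eq_lintegral_update ν hO B u hw]
    _ ≤ K' * ((∫⁻ z, φ z * ∫⁻ y, Φ z y ∂ν ∂ν) * ENNReal.ofReal (treeNumber B.card * p ^ (B.card - 1))) := by
        gcongr
        exact lintegral_mul_aU_le ν hO hOs hp0 hp B hu (hφ.mul hM)
    _ = _ := by ring

end Generic

/-! ## § 3 Tree sums with one and two roots -/

section TreeSums

open Literature.Probability.LatticeModels (treeSum treeSum_le_exp_one sum_filter_mem_eq_sum_powerset_erase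
  sum_setPartitions_eq_sum_block)

variable {α : Type*} [DecidableEq α]

/-- **One root**: `∑_{B ⊆ W, B ∋ i} t(#B) x^{#B−1} = U_x(W ∖ i)` (the tree sum of `HardCoreUrsell`).
[folklore] -/
theorem sum_filter_mem_treeNumber_mul_pow_pred (x : ℝ) (W : Finset α) {i : α} (hi : i ∈ W) :
    ∑ B ∈ W.powerset.filter (fun B => i ∈ B), (treeNumber B.card : ℝ) * x ^ (B.card - 1) =
      treeSum x (W.erase i) := by
  rw [sum_filter_mem_eq_sum_powerset_erase W hi, treeSum]
  refine Finset.sum_congr rfl fun U hU => ?_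
  have hiU : i ∉ U := fun h => (Finset.mem_erase.1 (Finset.mem_powerset.1 hU h)).1 rfl
  rw [Finset.card_insert_of_notMem hiU, Nat.add_sub_cancel]

/-- The tree recursion with a marked block: for `j ∈ U`,
`t(#U + 1) = ∑_{P₀ ⊆ U, P₀ ∋ j} #P₀ t(#P₀) t(#(U ∖ P₀) + 1)`. [folklore] -/
theorem treeNumber_succ_eq_sum_block (U : Finset α) {j : α} (hj : j ∈ U) :
    (treeNumber (U.card + 1) : ℝ) =
      ∑ P₀ ∈ U.powerset.filter (fun P => j ∈ P),
        (P₀.card : ℝ) * treeNumber P₀.card * treeNumber ((U \ P₀).card + 1) := by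
  rw [← sum_setPartitions_prod_card_mul_treeNumber U, Nat.cast_sum,
    sum_setPartitions_eq_sum_block hj]
  refine Finset.sum_congr rfl fun P₀ hP₀ => ?_
  obtain ⟨-, hjP₀⟩ := Finset.mem_filter.1 hP₀
  rw [← sum_setPartitions_prod_card_mul_treeNumber (U \ P₀), Nat.cast_sum, Finset.mul_sum]
  refine Finset.sum_congr rfl fun κ hκ => ?_
  have hκ' := mem_setPartitions.1 hκ
  rw [Finset.prod_insert (hκ'.notMem_of_sdiff ⟨j, hjP₀⟩)]
  push_cast
  ring

/-- **Two roots in one block.** If `x ≥ 0` and `2 e x #W ≤ 1` then for `i ≠ j` in `W`,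
`∑_{B ⊆ W, B ∋ i, j} t(#B) x^{#B−2} ≤ e²`: write `B = {i} ∪ U`, expand `t(#U + 1)` over the block `P₀ ∋ j`
(`treeNumber_succ_eq_sum_block`), resum `U ∖ P₀` freely (a tree sum `≤ e`), and bound
`∑_{P₀ ∋ j} #P₀ t(#P₀) x^{#P₀−1} ≤ U_{2x} ≤ e` using `m + 1 ≤ 2^m`. [folklore] -/
theorem sum_filter_mem_mem_treeNumber_mul_pow_le {x : ℝ} (hx : 0 ≤ x) (W : Finset α) {i j : α}
    (hi : i ∈ W) (hij : i ≠ j) (hW : 2 * Real.exp 1 * x * W.card ≤ 1) :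
    ∑ B ∈ (W.powerset.filter (fun B => i ∈ B)).filter (fun B => j ∈ B),
        (treeNumber B.card : ℝ) * x ^ (B.card - 2) ≤ Real.exp 1 * Real.exp 1 := by
  set W' : Finset α := W.erase i with hW'
  have hW'c : (W'.card : ℝ) ≤ W.card := by exact_mod_cast Finset.card_le_card (Finset.erase_subset i W)
  have he : 0 ≤ Real.exp 1 := (Real.exp_pos 1).le
  -- Step 1: `B = insert i U`, `U ⊆ W \ i`, `j ∈ U`
  have h1 : ∑ B ∈ (W.powerset.filter (fun B => i ∈ B)).filter (fun B => j ∈ B),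
      (treeNumber B.card : ℝ) * x ^ (B.card - 2) =
        ∑ U ∈ W'.powerset.filter (fun U => j ∈ U), (treeNumber (U.card + 1) : ℝ) * x ^ (U.card - 1) := by
    rw [Finset.sum_filter, sum_filter_mem_eq_sum_powerset_erase W hi, Finset.sum_filter]
    refine Finset.sum_congr rfl fun U hU => ?_
    have hiU : i ∉ U := fun h => (Finset.mem_erase.1 (Finset.mem_powerset.1 hU h)).1 rfl
    have hjins : j ∈ insert i U ↔ j ∈ U := by simp [hij.symm]
    simp only [hjins, Finset.card_insert_of_notMem hiU]
    rfl
  -- Step 2: expand `t(#U+1)` over the block of `j` and split the power of `x`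
  have h2 : ∀ U ∈ W'.powerset.filter (fun U => j ∈ U),
      (treeNumber (U.card + 1) : ℝ) * x ^ (U.card - 1) =
        ∑ P₀ ∈ U.powerset.filter (fun P => j ∈ P),
          ((P₀.card : ℝ) * treeNumber P₀.card * x ^ (P₀.card - 1)) *
            (treeNumber ((U \ P₀).card + 1) * x ^ (U \ P₀).card) := by
    intro U hU
    obtain ⟨-, hjU⟩ := Finset.mem_filter.1 hU
    rw [treeNumber_succ_eq_sum_block U hjU, Finset.sum_mul]
    refine Finset.sum_congr rfl fun P₀ hP₀ => ?_
    obtain ⟨hP₀U, hjP₀⟩ := Finset.mem_filter.1 hP₀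
    have hcard : U.card = P₀.card + (U \ P₀).card := by
      rw [Finset.card_sdiff_of_subset (Finset.mem_powerset.1 hP₀U)]
      have := Finset.card_le_card (Finset.mem_powerset.1 hP₀U)
      omega
    have hP₀pos : 1 ≤ P₀.card := Finset.card_pos.2 ⟨j, hjP₀⟩
    have hpow : x ^ (U.card - 1) = x ^ (P₀.card - 1) * x ^ (U \ P₀).card := by
      rw [← pow_add]; congr 1; omega
    rw [hpow]; ring
  rw [h1, Finset.sum_congr rfl h2]
  -- Step 3: resum over `(P₀, R = U \ P₀)`
  have h3 : ∑ U ∈ W'.powerset.filter (fun U => j ∈ U), ∑ P₀ ∈ U.powerset.filter (fun P => j ∈ P),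
      ((P₀.card : ℝ) * treeNumber P₀.card * x ^ (P₀.card - 1)) *
        (treeNumber ((U \ P₀).card + 1) * x ^ (U \ P₀).card) =
      ∑ P₀ ∈ W'.powerset.filter (fun P => j ∈ P),
        ((P₀.card : ℝ) * treeNumber P₀.card * x ^ (P₀.card - 1)) * treeSum x (W' \ P₀) := by
    simp_rw [treeSum, Finset.mul_sum]
    rw [Finset.sum_sigma', Finset.sum_sigma']
    refine Finset.sum_nbij' (fun y => ⟨y.2, y.1 \ y.2⟩) (fun z => ⟨z.1 ∪ z.2, z.1⟩) ?_ ?_ ?_ ?_ ?_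
    · rintro ⟨U, P₀⟩ hy
      simp only [Finset.mem_sigma, Finset.mem_filter, Finset.mem_powerset] at hy ⊢
      exact ⟨⟨hy.2.1.trans hy.1.1, hy.2.2⟩, Finset.sdiff_subset_sdiff hy.1.1 le_rfl⟩
    · rintro ⟨P₀, R⟩ hz
      simp only [Finset.mem_sigma, Finset.mem_filter, Finset.mem_powerset] at hz ⊢
      refine ⟨⟨Finset.union_subset hz.1.1 (hz.2.trans Finset.sdiff_subset), Finset.mem_union_left _ hz.1.2⟩,
        Finset.subset_union_left, hz.1.2⟩
    · rintro ⟨U, P₀⟩ hy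
      simp only [Finset.mem_sigma, Finset.mem_filter, Finset.mem_powerset] at hy
      simp only [Finset.union_sdiff_of_subset hy.2.1]
    · rintro ⟨P₀, R⟩ hz
      simp only [Finset.mem_sigma, Finset.mem_filter, Finset.mem_powerset] at hz
      have hdisj : Disjoint P₀ R := Finset.disjoint_of_subset_right hz.2 Finset.disjoint_sdiff
      simp only [Finset.union_sdiff_cancel_left hdisj]
    · rintro ⟨U, P₀⟩ hy
      rfl
  rw [h3]
  -- Step 4: the free tree sum is `≤ e`, and `∑_{P₀ ∋ j} #P₀ t(#P₀) x^{#P₀ - 1} ≤ U_{2x}(W' \ j) ≤ e`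
  have h4 : ∀ P₀ ∈ W'.powerset.filter (fun P => j ∈ P), treeSum x (W' \ P₀) ≤ Real.exp 1 := by
    intro P₀ _
    refine treeSum_le_exp_one hx _ ?_
    have hc : ((W' \ P₀).card : ℝ) ≤ W.card := by
      exact_mod_cast (Finset.card_le_card Finset.sdiff_subset).trans (Finset.card_le_card (Finset.erase_subset i W))
    nlinarith [mul_nonneg he hx]
  have hterm0 : ∀ P₀ ∈ W'.powerset.filter (fun P => j ∈ P),
      0 ≤ (P₀.card : ℝ) * treeNumber P₀.card * x ^ (P₀.card - 1) := fun P₀ _ => by positivity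
  calc ∑ P₀ ∈ W'.powerset.filter (fun P => j ∈ P),
        ((P₀.card : ℝ) * treeNumber P₀.card * x ^ (P₀.card - 1)) * treeSum x (W' \ P₀)
      ≤ ∑ P₀ ∈ W'.powerset.filter (fun P => j ∈ P),
          ((P₀.card : ℝ) * treeNumber P₀.card * x ^ (P₀.card - 1)) * Real.exp 1 :=
        Finset.sum_le_sum fun P₀ hP₀ => mul_le_mul_of_nonneg_left (h4 P₀ hP₀) (hterm0 P₀ hP₀)
    _ = (∑ P₀ ∈ W'.powerset.filter (fun P => j ∈ P),
          (P₀.card : ℝ) * treeNumber P₀.card * x ^ (P₀.card - 1)) * Real.exp 1 := by rw [Finset.sum_mul]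
    _ ≤ treeSum (2 * x) (W'.erase j) * Real.exp 1 := by
        refine mul_le_mul_of_nonneg_right ?_ he
        by_cases hjW' : j ∈ W'
        · rw [sum_filter_mem_eq_sum_powerset_erase W' hjW', treeSum]
          refine Finset.sum_le_sum fun V hV => ?_
          have hjV : j ∉ V := fun h => (Finset.mem_erase.1 (Finset.mem_powerset.1 hV h)).1 rfl
          rw [Finset.card_insert_of_notMem hjV, Nat.add_sub_cancel, mul_pow]
          have h2V' : V.card + 1 ≤ 2 ^ V.card := Nat.lt_two_pow_self
          have h2V : (V.card : ℝ) + 1 ≤ 2 ^ V.card := by exact_mod_cast h2V'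
          have ht : 0 ≤ (treeNumber (V.card + 1) : ℝ) * x ^ V.card := by positivity
          push_cast
          nlinarith
        · have hempty : W'.powerset.filter (fun P => j ∈ P) = ∅ := by
            refine Finset.filter_eq_empty_iff.2 fun P hP hjP => hjW' (Finset.mem_powerset.1 hP hjP)
          rw [hempty, Finset.sum_empty]
          exact Literature.Probability.LatticeModels.treeSum_nonneg (by linarith) _
    _ ≤ Real.exp 1 * Real.exp 1 := by
        refine mul_le_mul_of_nonneg_right (treeSum_le_exp_one (by linarith) _ ?_) he
        have hc : ((W'.erase j).card : ℝ) ≤ W.card := by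
          exact_mod_cast (Finset.card_le_card (Finset.erase_subset j W')).trans
            (Finset.card_le_card (Finset.erase_subset i W))
        nlinarith [mul_nonneg he hx]

end TreeSums

/-! ## § 4 The registered sub-goal -/

/-- **Registered sub-goal `stub_contactStatistics_tail`** (third piece of stub `stub_contactStatistics`, S2c,
of the line `enskog-compensator-martingale`): the geometric tail machinery of the two-marked expansion,
uniform in the number of labels — (i) the sharp insertion ratio `Ξ(univ ∖ B)(1 − n p)^{#B} ≤ Ξ(univ)` for `n`
independent `ν`-distributed points of `ℝ³` with one excluded region of mass `≤ p`, `n p ≤ 1`; (ii) the one-root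
tree sum `∑_{B ⊆ W, B ∋ i} t(#B) x^{#B−1} ≤ e` for `e x #W ≤ 1`; (iii) the two-root tree sum
`∑_{B ⊆ W, B ∋ i, j} t(#B) x^{#B−2} ≤ e²` for `i ≠ j`, `2 e x #W ≤ 1`; (iv) the tree bound with a two-body weight
for two marked points `u ∈ B`, `v ∈ B'` in disjoint blocks. [cite: PulvirentiTsagkarogiannis2012, §4] -/
theorem stub_contactStatistics_tail : (∀ (n : ℕ) (ν : Measure V3) [IsProbabilityMeasure ν] (O : V3 → V3 → Prop),
    MeasurableSet {p : V3 × V3 | O p.1 p.2} → (∀ a b, O a b → O b a) → ∀ (p : ℝ), 0 ≤ p →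
    (∀ z, ν {y | O z y} ≤ ENNReal.ofReal p) → (n : ℝ) * p ≤ 1 → ∀ B : Finset (Fin n),
    hcProb O ν ((Finset.univ : Finset (Fin n)) \ B) * (1 - n * p) ^ B.card ≤
      hcProb O ν (Finset.univ : Finset (Fin n))) ∧
    (∀ (n : ℕ) (x : ℝ), 0 ≤ x → ∀ (W : Finset (Fin n)) (i : Fin n), i ∈ W → Real.exp 1 * x * W.card ≤ 1 →
      ∑ B ∈ W.powerset.filter (fun B => i ∈ B), (treeNumber B.card : ℝ) * x ^ (B.card - 1) ≤ Real.exp 1) ∧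
    (∀ (n : ℕ) (x : ℝ), 0 ≤ x → ∀ (W : Finset (Fin n)) (i j : Fin n), i ∈ W → i ≠ j →
      2 * Real.exp 1 * x * W.card ≤ 1 →
      ∑ B ∈ (W.powerset.filter (fun B => i ∈ B)).filter (fun B => j ∈ B),
        (treeNumber B.card : ℝ) * x ^ (B.card - 2) ≤ Real.exp 1 * Real.exp 1) ∧
    (∀ (n : ℕ) (ν : Measure V3) [IsProbabilityMeasure ν] (O : V3 → V3 → Prop),
      MeasurableSet {p : V3 × V3 | O p.1 p.2} → (∀ a b, O a b → O b a) → ∀ (p : ℝ), 0 ≤ p →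
      (∀ z, ν {y | O z y} ≤ ENNReal.ofReal p) → ∀ (B B' : Finset (Fin n)) (u v : Fin n), u ∈ B → v ∈ B' →
      Disjoint B B' → ∀ (φ : V3 → ℝ≥0∞), Measurable φ → ∀ (Φ : V3 → V3 → ℝ≥0∞),
      Measurable (fun q : V3 × V3 => Φ q.1 q.2) →
      ∫⁻ x, φ (x u) * Φ (x u) (x v) * (aU O x B * aU O x B') ∂Measure.pi (fun _ : Fin n => ν) ≤
        (∫⁻ z, φ z * ∫⁻ y, Φ z y ∂ν ∂ν) * ENNReal.ofReal (treeNumber B.card * p ^ (B.card - 1)) *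
          ENNReal.ofReal (treeNumber B'.card * p ^ (B'.card - 1))) := by
  refine ⟨fun n ν _ O hO hOs p hp0 hp hnp B => ?_, fun n x hx W i hi hW => ?_,
    fun n x hx W i j hi hij hW => sum_filter_mem_mem_treeNumber_mul_pow_le hx W hi hij hW,
    fun n ν _ O hO hOs p hp0 hp B B' u v hu hv hBB' φ hφ Φ hΦ =>
      lintegral_mul_mul₂_aU_aU_le ν hO hOs hp0 hp hu hv hBB' hφ hΦ⟩
  · have h := hcProb_univ_sdiff_mul_pow_le ν hO hOs hp0 hp (by simpa using hnp) B
    simpa using h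
  · rw [sum_filter_mem_treeNumber_mul_pow_pred x W hi]
    refine Literature.Probability.LatticeModels.treeSum_le_exp_one hx _ (le_trans ?_ hW)
    have hc : ((W.erase i).card : ℝ) ≤ W.card := by exact_mod_cast Finset.card_le_card (Finset.erase_subset i W)
    have he : 0 ≤ Real.exp 1 * x := mul_nonneg (Real.exp_pos 1).le hx
    nlinarith

end Summit.AtomisticToContinuum.HydrodynamicLimit.Theorems.EnskogCompensator

end
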